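import Mathlib
import Summits.ValiantsHypothesis.ValiantsHypothesis.Theses.PermanentalCones
import Summits.ValiantsHypothesis.ValiantsHypothesis.Theorems.PermanentalConesPermanentalHyperbolic
import Summits.ValiantsHypothesis.ValiantsHypothesis.Theorems.PermanentalConesPermanentalConeHardGardingGradient
import Summits.ValiantsHypothesis.ValiantsHypothesis.Theorems.PermanentalConesPermanentalConeHardShadowSlackFactor
import Literature.AlgebraicGeometry.HyperbolicPolynomials.HyperbolicityCone
import Literature.AlgebraicGeometry.HyperbolicPolynomials.SmoothBoundary
import Literature.AlgebraicGeometry.HyperbolicPolynomials.SpectrahedralShadow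

/-!
# Birth skeleton — crux `PermanentalCones.PermanentalConeHard` (stmt-ValiantsHypothesis-8654), line `birth`
(the `SlackPsdRank` child foreseen in the route's two-layer plan), stated over the landed notions
`hyperbolicityCone`, `IsHyperbolic`, `gradForm`, `IsSpectrahedralShadowOfSize` of
`Literature.AlgebraicGeometry.HyperbolicPolynomials` (the crux inlines exactly these shapes).

H+ (`PermanentalConeHard`) asks for permanental witnesses `Q_n = per[(Y_n)_{rows<r n}; s^{(n−r n)}]`
(entrywise nonnegative `Y_n`) that are hyperbolic w.r.t. `𝟙` and whose closed hyperbolicity cones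
`K_n = Λ₊(Q_n, 𝟙) = {x : Q_n(x + τ𝟙) ≠ 0 ∀ τ > 0}` have NO lifted-LMI description
`{x : ∃ y, A(x,y) + B ⪰ 0}` of quasi-polynomial size.  A `∀` over all lifts `(p, A, B)` has no direct
handle; the one known handle on the size of semidefinite lifts is the Yannakakis–Gouveia–Parrilo–Thomas
factorisation principle: a lift of size `m` forces every SLACK MATRIX `S[i,k] = ℓ_k(x_i)` (points
`x_i ∈ K`, linear functionals `ℓ_k ≥ 0` on `K`) to factor as `S[i,k] = tr(U_i V_k)` with
`U_i, V_k ∈ 𝕊^m_+` (psd-rank `≤ m`).  The line has three stubs: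

* `stub_shadowSlackFactor` (TOOL, provable now, M/L): the factorisation principle for lifted-LMI
  descriptions `IsSpectrahedralShadowOfSize K m` of a set `K ∋ 0` — conic duality for
  `min ℓ_k(x) s.t. A(x,y) + B ⪰ 0` on the affine subspace where `A(x,y) + B` is symmetric, after
  facial reduction to the minimal face `F ≅ 𝕊^{m'}_+` of `𝕊^m_+` containing the feasible image
  (Slater holds in `F`, the value `0` is attained at `x = 0`, so a dual multiplier `V_k ∈ F^*` with
  `ℓ_k(x) = ⟨V_k, A(x,y) + B⟩` identically exists; `U_i := A(x_i,y_i) + B ∈ F`, and `Π V_k Π ⪰ 0`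
  for the face projection `Π` has the same pairings).  Index types `ι, κ` are arbitrary: no
  finiteness is needed.  [Gouveia–Parrilo–Thomas arXiv:1111.3164 Thm 1 (lift ⇒ factorisation);
  Fawzi–Gouveia–Parrilo–Robinson–Thomas arXiv:1411.6317 §2–3 (psd rank, generalized slack matrices);
  facial reduction: Borwein–Wolkowicz 1981.]
* `stub_gardingGradient` (DICTIONARY, provable now, M): Gårding's dual-cone lemma — for a homogeneous
  `P` hyperbolic w.r.t. `e` with `P(e) > 0`, the gradient at ANY point `z` of the closed cone is a dual
  vector: `gradForm P z x = ⟨∇P(z), x⟩ = ∂_t P(z + t x)|₀ ≥ 0` for all `x ∈ Λ₊(P, e)` (for `z, x` in the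
  open cone `P(z + t x) = P(x)·∏(t + μ_j)` with all `μ_j > 0` by Gårding's theorem
  `IsHyperbolic.of_mem_openHyperbolicityCone` + `eval_add_smul_eq_eval_mul_prod_eigenvalues`, so the
  derivative is `> 0`; pass to the closure `hyperbolicityCone_eq_closure`).  Homogeneity is NECESSARY
  (`P = s + 1`, `n = 1`: `K = [-1, ∞)`, `∇P = 1`, `x = -1`).  [Gårding 1959; Renegar
  arXiv:math/0404222 §2–3; nearest landed: `coeff_one_linePoly_dir_pos` (boundary points, direction
  `e`), `eval_nonneg_of_mem`, `convex_hyperbolicityCone`, `gradForm_apply`.]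
* `stub_permanentalGradientPsdRank` (CORE, open — the crux in finite-certificate form, a TRANSFER of
  H+ to psd-RANK lower bounds for explicit nonnegative matrices of permanental derivative values):
  witnesses `r`, `Y ≥ 0` with `Q_n(𝟙) > 0` such that for every `c` some `n` has, for every
  `m ≤ 2^((log₂ n + c)^c)`, cone points `x_i, z_k ∈ K_n` whose GRADIENT SLACK MATRIX
  `S[i,k] = ⟨∇Q_n(z_k), x_i⟩` (sums of permanents of minors of `Y_n` weighted by monomials in `z_k`;
  Boolean points give matching counts) admits no psd factorisation of size `m`.  psd-rank is the
  format in which super-quasi-polynomial lower bounds exist at all (Lee–Raghavendra–Steurer, via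
  SOS degree, for 0/1 slack matrices); nothing of the kind is known for a non-polyhedral cone, which
  is exactly the crux's recorded "why it might fail".  The stub is essentially crux-equivalent (the
  converse direction is GPT's lift construction + compactness + `K^* = cl cone ∇Q(K)`), not cheaply.

Shape (skeleton audit by-name rule): `Stmt.stub_…` = the three statements as named `Prop`s;
`stub_…` = the same statements as theorems (the REGISTERED stubs; after wave 1 of lead c1 the TOOL and
DICTIONARY stubs are the landed Theorems decls `…Theorems.PermanentalConesPermanentalConeHard.stub_…`
(p144677, p143447) and the only remaining `sorry` is the CORE stub `stub_permanentalGradientPsdRank`);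
`PermanentalConeHard_of : Stmt.stub_shadowSlackFactor → Stmt.stub_gardingGradient →
Stmt.stub_permanentalGradientPsdRank → PermanentalConeHard` (real proof); `PermanentalConeHard_proof :
PermanentalConeHard := PermanentalConeHard_of stub_… stub_… stub_…` ties the two copies.

Assembly `PermanentalConeHard_of` (real proof, no sorry): witnesses from the core stub; `Q_n(𝟙) ≠ 0`
from positivity; real-rootedness from the LANDED support item `permanentalHyperbolic_proof`;
homogeneity of `Q_n` (degree `#{j : ¬ j < r n}`) proved here; the inline clauses are turned into
`IsHyperbolic`, `hyperbolicityCone`, `IsSpectrahedralShadowOfSize` (`mem_hyperbolicityCone_iff`,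
`x + τ • 𝟙 = (x_j + τ)_j`); a purported shadow `(p, A, B)` of size `m` then feeds the tool stub
(`0 ∈ K_n` by `zero_mem_hyperbolicityCone`, dual membership of `gradForm Q_n z_k` by Gårding's
lemma), producing the psd factorisation the core stub forbids.

BC3 (registrar's folder `bc/probes2_{crux,summit}.lean`, `bc/probes2_retry_{A,B,C}.lean`): for each
stub, `example : <stub signature> → PermanentalConeHard` and `… → ValiantsHypothesis` attacked by each
of `exact?`, `simpa`, `simpa [target]`, `aesop` (isolated examples, 400000 heartbeats; the 5 heartbeat
time-outs re-run at 1.6M–2M) — 24/24 FAIL (`exact?` could not close the goal / `assumption` failed /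
aesop: failed to prove the goal after exhaustive search).

Disproof used: none relevant (no `Disproof.lean` / Negative lemmas exist for this crux at
registration — `ledger crux ls stmt-ValiantsHypothesis-8654`: no workfiles).

Lead c2 (2026-08-17) — state of the line.  The only `sorry` is the CORE stub, which is H+ itself in
finite-certificate form (open problem).  Landed infrastructure (all `--supports`, namespace
`…Theorems.PermanentalConesPermanentalConeHard`): `PsdRankTools` (p148476: trace orthogonality,
triangular psd-rank bound `stub_psdRankTriangularBound`, rank obstruction
`stub_gradientFoolingPatternLeVars` — triangular certificates cap at `n`), `CoreLevelZero`
(p150334: level `c = 0` of the core stub PROVED, `stub_coreLevelZero`), `OrthantNotWitness`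
(p150967: the member `r n = 0` fails the size clause at `c = 1`; `levelOne_bound_gt`),
`OrthantRowsFactor` (p151727: rows in the orthant ⇒ size-`n` diagonal factorisation, so level
`c ≥ 1` witnesses need cone points with negative coordinates), and the FACET-CONTACT OBSTRUCTION
(`HyperplaneVanishing` p153028, `ContactVanishing` p153542, `KnapsackSpan` p153567, assembled in
`KnapsackSandwich` = `stub_noExactKnapsackSandwich`): a hyperbolicity cone sandwiched between the
correlation-polytope cone and its exact knapsack relaxation — the Lee–Raghavendra–Steurer
pattern-matrix configuration, the only super-quasi-polynomial psd-rank engine in print — has degree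
`≥ C(n,m)`, so the exact LRS embedding is impossible for any polynomial-degree (e.g. permanental)
cone (p154842; core-stub-language form `KnapsackZeroPattern` = `stub_noKnapsackZeroPatternEmbedding`,
p155430: gradient slack matrices of any homogeneous hyperbolic `Q` with `Q(𝟙) > 0` cannot reproduce
the LRS knapsack zero pattern on moment-vector rows unless `C(n,m) ≤ deg Q`); and
`AllOnesNotWitness` (p156580: the member `Y ≡ J`, `Q ∝ e_{n-r}`, has the Saunderson–Parrilo lift of
size `≤ 2^((⌊log₂ n⌋+4)^4)` for every `n, r` — witnesses need non-parallel constant rows).  The LRS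
theorem itself is filed as the named fact
`Literature.Combinatorics.Optimization.LeeRaghavendraSteurer2015_thm11` (p154760).  What remains
open is an ε-relaxed embedding = a polynomial-degree hyperbolic relaxation of CORR_n beating
degree-`m` SOS (`Cruxes/PermanentalConeHard/CORE-analysis-c2.md`).

Lead c3 (2026-08-17) — the CORE stub is now PROVED EQUIVALENT to the crux: `stub_coreIffCrux`
(p159378, `Theorems/…CoreIffCrux.lean`: `PermanentalConeHard ↔ Stmt.stub_permanentalGradientPsdRank`
verbatim; the new direction is the Gouveia–Parrilo–Thomas converse for cones cut out by their own
gradient functionals, `stub_gradientCut` p158917).  So no re-lining inside this reduction can make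
the open obligation smaller than H+ itself.  Witness pool shrunk from the Easy side (all
`--supports`): `stub_oneRowNotWitness` (p160789) and `stub_twoRowsNotWitness` (p161452, with the
wave-1 infrastructure p160260/p160333/p160441/p160471): members with `r n ≤ 2` POSITIVE constant
rows have lifted LMIs of size `≤ 2^((⌊log₂ n⌋+4)^4)` (`Λ₊(D_aD_b e_N) = Diag(b)·L⁻¹(spec
Λ₊(e_{n-1}^{(n)}))`, the planned `TwoDirections` statement of the Easy crux 8652 in no-go form), so
`permanental_atMostTwoRows_not_hard`: an H+ witness needs `r n ≥ 3` genuinely mixed rows.  The first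
open Easy case is `r = 3` = the mixed second derivative relaxation `Λ₊(Σ_{i<j}(λ_i+λ_j) det Z_{-ij})`
of the PSD cone (`Cruxes/PermanentalConeHard/CORE-analysis-c3.md`).
-/

-- `Summit.ValiantsHypothesis.ValiantsHypothesis.…` is the tree's single-conjunct layout (Sub = Summit).
set_option linter.dupNamespace false

namespace Summit.ValiantsHypothesis.ValiantsHypothesis.Cruxes.PermanentalConeHard.Birth

open Summit.ValiantsHypothesis.ValiantsHypothesis.Theses.PermanentalCones
open Literature.AlgebraicGeometry.HyperbolicPolynomials

/-! ## Stub statements as named `Prop`s (skeleton audit by-name rule, as in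
`Cruxes/BinomialCandidate/Lines/birth.lean`): `Stmt.stub_…` are the precise statements; the REGISTERED
stubs `stub_…` below restate them verbatim as sorried theorems (the only sorries of this file);
`PermanentalConeHard_of` takes the `Stmt` copies by name and `PermanentalConeHard_proof` ties the two. -/

/-- Statement of `stub_shadowSlackFactor` (TOOL). -/
def Stmt.stub_shadowSlackFactor : Prop :=
  ∀ (n m : ℕ) (K : Set (Fin n → ℝ)), IsSpectrahedralShadowOfSize K m → (0 : Fin n → ℝ) ∈ K →
    ∀ (ι κ : Type) (xs : ι → Fin n → ℝ) (ls : κ → (Fin n → ℝ) →ₗ[ℝ] ℝ),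
      (∀ i, xs i ∈ K) → (∀ k, ∀ x ∈ K, 0 ≤ ls k x) →
      ∃ (U : ι → Matrix (Fin m) (Fin m) ℝ) (V : κ → Matrix (Fin m) (Fin m) ℝ),
        (∀ i, (U i).PosSemidef) ∧ (∀ k, (V k).PosSemidef) ∧
        ∀ i k, ls k (xs i) = Matrix.trace (U i * V k)

/-- Statement of `stub_gardingGradient` (DICTIONARY). -/
def Stmt.stub_gardingGradient : Prop :=
  ∀ (n d : ℕ) (P : MvPolynomial (Fin n) ℝ) (e : Fin n → ℝ), P.IsHomogeneous d →
    IsHyperbolic P e → 0 < MvPolynomial.eval e P →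
    ∀ z ∈ hyperbolicityCone P e, ∀ x ∈ hyperbolicityCone P e, 0 ≤ gradForm P z x

/-- Statement of `stub_permanentalGradientPsdRank` (CORE). -/
def Stmt.stub_permanentalGradientPsdRank : Prop :=
  ∃ (r : ℕ → ℕ) (Y : ∀ n : ℕ, Matrix (Fin n) (Fin n) ℝ), (∀ n i j, 0 ≤ Y n i j) ∧
    ∀ P : ∀ n : ℕ, MvPolynomial (Fin n) ℝ,
      (∀ n, P n = (Matrix.of fun i j : Fin n =>
        if (i : ℕ) < r n then MvPolynomial.C (Y n i j) else MvPolynomial.X j).permanent) →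
      (∀ n : ℕ, 0 < MvPolynomial.eval (fun _ => (1 : ℝ)) (P n)) ∧
      ∀ c : ℕ, ∃ n : ℕ, ∀ m ≤ 2 ^ ((Nat.log 2 n + c) ^ c),
        ∃ (ι κ : Type) (xs : ι → Fin n → ℝ) (zs : κ → Fin n → ℝ),
          (∀ i, xs i ∈ hyperbolicityCone (P n) (fun _ => (1 : ℝ))) ∧
          (∀ k, zs k ∈ hyperbolicityCone (P n) (fun _ => (1 : ℝ))) ∧
          ¬ ∃ (U : ι → Matrix (Fin m) (Fin m) ℝ) (V : κ → Matrix (Fin m) (Fin m) ℝ),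
              (∀ i, (U i).PosSemidef) ∧ (∀ k, (V k).PosSemidef) ∧
              ∀ i k, gradForm (P n) (zs k) (xs i) = Matrix.trace (U i * V k)

/-- **TOOL (GPT factorisation from a lifted-LMI description).**  If `K ⊆ ℝ^n` has a lifted-LMI
description of size `m` and contains `0`, then for any points `xs i ∈ K` and any linear functionals
`ls k` nonnegative on `K` the slack matrix `(ls k (xs i))` has a positive-semidefinite
factorisation of size `m`. -/
theorem stub_shadowSlackFactor :
    ∀ (n m : ℕ) (K : Set (Fin n → ℝ)), IsSpectrahedralShadowOfSize K m → (0 : Fin n → ℝ) ∈ K →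
      ∀ (ι κ : Type) (xs : ι → Fin n → ℝ) (ls : κ → (Fin n → ℝ) →ₗ[ℝ] ℝ),
        (∀ i, xs i ∈ K) → (∀ k, ∀ x ∈ K, 0 ≤ ls k x) →
        ∃ (U : ι → Matrix (Fin m) (Fin m) ℝ) (V : κ → Matrix (Fin m) (Fin m) ℝ),
          (∀ i, (U i).PosSemidef) ∧ (∀ k, (V k).PosSemidef) ∧
          ∀ i k, ls k (xs i) = Matrix.trace (U i * V k) :=
  -- LANDED (wave 1, p144677 + helper file p144425): Theorems/PermanentalConesPermanentalConeHardShadowSlackFactor.lean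
  Summit.ValiantsHypothesis.ValiantsHypothesis.Theorems.PermanentalConesPermanentalConeHard.stub_shadowSlackFactor

/-- **DICTIONARY (Gårding's dual-cone lemma).**  For a homogeneous `P ∈ ℝ[s_1..s_n]` hyperbolic
w.r.t. `e` with `P(e) > 0`, the gradient pairing `gradForm P z x = ⟨∇P(z), x⟩` is nonnegative for
all `z, x` in the closed hyperbolicity cone `Λ₊(P, e)`. -/
theorem stub_gardingGradient :
    ∀ (n d : ℕ) (P : MvPolynomial (Fin n) ℝ) (e : Fin n → ℝ), P.IsHomogeneous d →
      IsHyperbolic P e → 0 < MvPolynomial.eval e P →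
      ∀ z ∈ hyperbolicityCone P e, ∀ x ∈ hyperbolicityCone P e, 0 ≤ gradForm P z x :=
  -- LANDED (wave 1, p143447): Theorems/PermanentalConesPermanentalConeHardGardingGradient.lean
  Summit.ValiantsHypothesis.ValiantsHypothesis.Theorems.PermanentalConesPermanentalConeHard.stub_gardingGradient

/-- **CORE (permanental gradient slack matrices have super-quasi-polynomial psd-rank).**  There are
`r` and entrywise nonnegative `Y_n` with `Q_n(𝟙) > 0` such that for every `c` some `n` admits, for
every `m ≤ 2^((log₂ n + c)^c)`, cone points `xs i`, `zs k ∈ Λ₊(Q_n, 𝟙)` whose gradient slack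
matrix `gradForm Q_n (zs k) (xs i) = ⟨∇Q_n(zs k), xs i⟩` has NO positive-semidefinite factorisation
of size `m`. -/
theorem stub_permanentalGradientPsdRank :
    ∃ (r : ℕ → ℕ) (Y : ∀ n : ℕ, Matrix (Fin n) (Fin n) ℝ), (∀ n i j, 0 ≤ Y n i j) ∧
      ∀ P : ∀ n : ℕ, MvPolynomial (Fin n) ℝ,
        (∀ n, P n = (Matrix.of fun i j : Fin n =>
          if (i : ℕ) < r n then MvPolynomial.C (Y n i j) else MvPolynomial.X j).permanent) →
        (∀ n : ℕ, 0 < MvPolynomial.eval (fun _ => (1 : ℝ)) (P n)) ∧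
        ∀ c : ℕ, ∃ n : ℕ, ∀ m ≤ 2 ^ ((Nat.log 2 n + c) ^ c),
          ∃ (ι κ : Type) (xs : ι → Fin n → ℝ) (zs : κ → Fin n → ℝ),
            (∀ i, xs i ∈ hyperbolicityCone (P n) (fun _ => (1 : ℝ))) ∧
            (∀ k, zs k ∈ hyperbolicityCone (P n) (fun _ => (1 : ℝ))) ∧
            ¬ ∃ (U : ι → Matrix (Fin m) (Fin m) ℝ) (V : κ → Matrix (Fin m) (Fin m) ℝ),
                (∀ i, (U i).PosSemidef) ∧ (∀ k, (V k).PosSemidef) ∧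
                ∀ i k, gradForm (P n) (zs k) (xs i) = Matrix.trace (U i * V k) := by
  sorry

/-- **Assembly** — the three stub STATEMENTS imply the crux BY NAME (real proof, no `sorry`). -/
theorem PermanentalConeHard_of :
    Stmt.stub_shadowSlackFactor → Stmt.stub_gardingGradient → Stmt.stub_permanentalGradientPsdRank →
      PermanentalConeHard := by
  intro h1 h2 h3
  unfold Stmt.stub_shadowSlackFactor at h1
  unfold Stmt.stub_gardingGradient at h2
  unfold Stmt.stub_permanentalGradientPsdRank at h3
  obtain ⟨r, Y, hY, h⟩ := h3
  refine ⟨r, Y, hY, fun P hP => ?_⟩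
  obtain ⟨hpos, hhard⟩ := h P hP
  -- `Q_n(𝟙) ≠ 0` from positivity.
  have h1ne : ∀ n, MvPolynomial.eval (fun _ => (1 : ℝ)) (P n) ≠ 0 := fun n => (hpos n).ne'
  -- Real-rootedness along `x + z𝟙`: the LANDED support item `PermanentalHyperbolic`.
  have hhyp : ∀ (n : ℕ) (x : Fin n → ℝ) (z : ℂ), MvPolynomial.eval (fun j => (x j : ℂ) + z)
      (MvPolynomial.map (algebraMap ℝ ℂ) (P n)) = 0 → z.im = 0 :=
    fun n => Summit.ValiantsHypothesis.ValiantsHypothesis.Theorems.permanentalHyperbolic_proof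
      n (r n) (Y n) (hY n) (P n) (hP n) (h1ne n)
  refine ⟨fun n => ⟨h1ne n, hhyp n⟩, fun c => ?_⟩
  obtain ⟨n, hn⟩ := hhard c
  refine ⟨n, fun m hm p A B hrep => ?_⟩
  obtain ⟨ι, κ, xs, zs, hxs, hzs, hno⟩ := hn m hm
  -- Homogeneity of the permanental witness: every summand has degree `#{j : ¬ j < r n}`.
  have hhom : (P n).IsHomogeneous (∑ j : Fin n, (if (j : ℕ) < r n then 0 else 1)) := by
    rw [hP n]
    unfold Matrix.permanent
    refine MvPolynomial.IsHomogeneous.sum _ _ _ (fun σ _ => ?_)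
    have hprod := MvPolynomial.IsHomogeneous.prod (Finset.univ : Finset (Fin n))
      (fun i => (Matrix.of fun i j : Fin n =>
        if (i : ℕ) < r n then MvPolynomial.C (Y n i j) else MvPolynomial.X j) (σ i) i)
      (fun i => if ((σ i : Fin n) : ℕ) < r n then 0 else 1) (fun i _ => ?_)
    · rwa [Equiv.sum_comp σ (fun j : Fin n => if (j : ℕ) < r n then (0 : ℕ) else 1)] at hprod
    · simp only [Matrix.of_apply]
      split_ifs
      · exact MvPolynomial.isHomogeneous_C _ _
      · exact MvPolynomial.isHomogeneous_X _ _
  -- Named-notion bridge: the inline clauses of the crux are `IsHyperbolic`, `hyperbolicityCone`,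
  -- `IsSpectrahedralShadowOfSize` for the direction `𝟙 = fun _ => 1`.
  have hline : ∀ (x : Fin n → ℝ) (τ : ℝ), x + τ • (fun _ : Fin n => (1 : ℝ)) = fun j => x j + τ := by
    intro x τ
    funext j
    simp
  have hmem : ∀ x : Fin n → ℝ, x ∈ hyperbolicityCone (P n) (fun _ => (1 : ℝ)) ↔
      ∀ τ : ℝ, 0 < τ → MvPolynomial.eval (fun j => x j + τ) (P n) ≠ 0 := fun x =>
    (mem_hyperbolicityCone_iff _ _ _).trans (forall_congr' fun τ => by rw [hline x τ])
  have hIs : IsHyperbolic (P n) (fun _ => (1 : ℝ)) :=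
    ⟨h1ne n, fun x z hz => hhyp n x z (by simpa using hz)⟩
  have hshadow : IsSpectrahedralShadowOfSize (hyperbolicityCone (P n) (fun _ => (1 : ℝ))) m :=
    ⟨p, A, B, fun x => (hmem x).trans (hrep x)⟩
  have h0 : (0 : Fin n → ℝ) ∈ hyperbolicityCone (P n) (fun _ => (1 : ℝ)) :=
    zero_mem_hyperbolicityCone hhom (h1ne n)
  -- The purported shadow `(p, A, B)` factorises the gradient slack matrix: contradiction.
  exact hno (h1 n m _ hshadow h0 ι κ xs (fun k => gradForm (P n) (zs k)) hxs
    (fun k x hx => h2 n _ (P n) (fun _ => 1) hhom hIs (hpos n) (zs k) (hzs k) x hx))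

/-- THE SKELETON: the crux, modulo exactly the three registered stubs (the compiler checks that the
`Stmt` copies and the stub statements agree). -/
theorem PermanentalConeHard_proof : PermanentalConeHard :=
  PermanentalConeHard_of stub_shadowSlackFactor stub_gardingGradient stub_permanentalGradientPsdRank

end Summit.ValiantsHypothesis.ValiantsHypothesis.Cruxes.PermanentalConeHard.Birth
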